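/-
Copyright (c) 2026 the pub-hodgecm-mathlib formalisation cell (harness21).  Prover seat hodgecm-mathlib-K2Liu-p01 (g3): Track B «K2-LIT»,
#184♮ = hLiu418 = stmt-HodgeConjecture-24832; organ file 3∕4 for socket #30a `sig_K2LiuThetaTypeSphericalEigenvaluesSplit` at a GENERAL
enumeration `e₁` (LEAD F0P6-plan (g10) RULINGS 2026-09-04T01:20:48Z (a) and 01:30:25Z); 2026-09-04.
-/
import Summits.HodgeConjecture.HodgeConjecture.Theorems.K2LiuSplitPlaceHeckeJunctionEnum
import Literature.NumberTheory.Automorphic.Liu2021.LemD1SplitPlaceHeckeEigenvaluesChain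
import HarnessLib

/-!
# Crux `HLiu418`, Track B road `K2_Liu`, unit U5c: [Liu2021, Lem. D.1 (2)+(4)] at the split places — the CHAIN and reading (B) at an
# ARBITRARY enumeration `e : Fin 2 × Fin 1 ≃ Fin 2` and an arbitrary line parameter `a : (L⁺)ˣ`

Cell `hodgecm-mathlib`, crux item hLiu418 = `stmt-HodgeConjecture-24832`; LEAD F0P6-plan (g10), planner K2Liu-plan (g2), prover K2Liu-p01 (g3).
THEOREMS ONLY (no `def`, no instance, no notation, no named-fact hypothesis, no `sorry`); lane `--supports stmt-HodgeConjecture-24832`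
(count-neutral helper).  Heart-beat cap: the chain carries `maxHeartbeats 400000` as its ★ twin (measured there: 0.25 M by import).

* **`lemD1_splitPlace_heckeEigenvalues_chain_enum`** — ★ `lemD1_splitPlace_heckeEigenvalues_chain` with `finProdFinEquiv ↦ e`, `r.toFun ε ↦ a`:
  S4c-G ★ `rhoVAtLine_congr_heckeTAt_apply_eq_smul` (generic in `e₁`) at THE CM `θ`-package `cmFinLocalFamily L e …`, fed with the
  `e`-general junction ★ `K2LiuSplitPlaceHeckeJunctionEnum.cm_hloc_one∕two_enum` and ★ `exists_finite_splitPlace_conditions'` (the big form's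
  hermitian∕unit facts at `e` from ★ `K2LiuSplitPlaceHeckeLocalEnum`); the 40-line proof is the ★ chain's, token for token otherwise.
* **`lemD1_splitPlace_heckeEigenvalues_muCarrier_enum`** — reading (B) on algebraic Hecke characters for a conjugate-symplectic `μ`
  (★ `eigen_eq_labels_of_chain`), at any `e`, `a` — the form socket #30a consumes.

HONEST LABEL.  Count-neutral organ toward socket #30a (general `e₁`); retires nothing by itself: `HC_CM` is proved only modulo the 7 printed
citations (2 remaining named inputs: hLiu418 = `stmt-HodgeConjecture-24832`, h413 = `stmt-HodgeConjecture-24833`) until rung 0 closes.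

## References
* [Liu2021] Y. Liu, *Fourier–Jacobi cycles and arithmetic relative trace formula*, Camb. J. Math. 9 (2021) = arXiv:2102.11518: App. D §D.1
  Lemma D.1 (2)–(4) (l. 5229–5235) and its proof, first paragraph (l. 5241, p. 126); Def. 4.11 (l. 2083–2097).
* [GelbartRogawski1991] S. Gelbart, J. Rogawski, Invent. Math. 105 (1991), §3.1 Prop. 3.1.1 p. 455, §3.2 p. 457.
* [CartierCorvallis1979] P. Cartier, PSPM 33 part 1 (1979), §IV.1–IV.2 (4.2).
* [PlatonovRapinchuk1994] V. Platonov, A. Rapinchuk, *Algebraic Groups and Number Theory* (1994), §5.1.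
-/

set_option autoImplicit false

noncomputable section


open scoped Matrix Kronecker TensorProduct Classical RestrictedProduct MatrixGroups NumberField
open NumberField NumberField.InfinitePlace IsDedekindDomain Filter Set MulAction
open Literature.NumberTheory Literature.NumberTheory.Automorphic Literature.NumberTheory.Automorphic.UnitaryGroup
open Literature.NumberTheory.GelbartRogawski1991 Literature.NumberTheory.GelbartRogawski1991.UnitaryDualPair
open Literature.NumberTheory.GelbartRogawski1991.UnitaryDualPair.WeilCoinv
open Literature.NumberTheory.GelbartRogawski1991.GRConstruction
open Literature.NumberTheory.Weil1964 Literature.RepresentationTheory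
open Literature.RepresentationTheory.HeisenbergGroup
open Literature.NumberTheory.GaloisRepresentations Literature.RepresentationTheory.HarrisKudlaSweet1996
open Literature.NumberTheory.Automorphic.Liu2021.Def411WeilCarriersDoubling
open Literature.NumberTheory.Automorphic.Liu2021 Literature.NumberTheory.Automorphic.Liu2021.Def411WeilCarriers
open Literature.NumberTheory.Automorphic.IdeleClassGroup Literature.RepresentationTheory.Liu2021
open Literature.NumberTheory.GelbartRogawski1991.UnitaryDualPair.LocalSplitting

namespace Summit.HodgeConjecture.HodgeConjecture.Cruxes.HLiu418.K2LiuSplitPlaceHeckeChainEnum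

open Summit.HodgeConjecture.HodgeConjecture.Cruxes.HLiu418

/-! ## §1 The θ-generic chain form at an arbitrary enumeration -/

set_option maxHeartbeats 400000 in -- measured 2026-09-04 (K2Liu-p01 g3): ≤ 400 000 (the cell ceiling; ★ twin `lemD1_splitPlace_heckeEigenvalues_chain` 0.25 M by import)
/-- **[Liu2021, Lem. D.1 (2)+(4)] at the split places, rank 2 — the θ-GENERIC CHAIN FORM at an ARBITRARY enumeration
`e : Fin 2 × Fin 1 ≃ Fin 2` and an arbitrary line parameter `a : (L⁺)ˣ`** (★ `lemD1_splitPlace_heckeEigenvalues_chain` is the case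
`e = finProdFinEquiv`, `a = r.toFun ε`): for ANY unitary splitting character `θ`, off ONE finite set of places of `L`, at every split `w` with
`J⋆_w ∈ GL₂(𝒪_w)`, every hyperspecial `K`, every `x ∈ (ω⋆_θ ∘ congr⁻¹)^K`: `T_{w,1} x = (√q_w·(θ_w(ϖ_w) + χ̌_w(ϖ_w)·θ_w(ϖ_w)⁻¹)) • x` and
`T_{w,2} x = χ̌_w(ϖ_w) • x`.  Proof = the ★ chain's, with S4c-G (generic in `e₁`) fed by the `e`-general junction ★ `cm_hloc_one∕two_enum`.
[cite: Liu2021, App. D proof of Lemma D.1, first paragraph (l. 5241, p. 126); Lemma D.1 (2), (4) (l. 5229–5235)] [cite: GelbartRogawski1991, §3.2 p. 457] [cite: CartierCorvallis1979, §IV.2 (4.2)] [cite: PlatonovRapinchuk1994, §5.1] -/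
theorem lemD1_splitPlace_heckeEigenvalues_chain_enum (L : Type) [Field L] [NumberField L] [IsCMField L]
    (θ : HeckeCharacter L) (hθu : θ.IsUnitary) (hθs : IsSplittingChar L 1 θ)
    (Jstar : Matrix (Fin 2) (Fin 2) L) (t : L) (ht : t ≠ 0) (gstar : GL (Fin 2) L)
    (dJ : Fin 2 → L) (hdJ : ∀ i, IsCMField.complexConj L (dJ i) = dJ i) (hdJ0 : ∀ i, dJ i ≠ 0)
    (hg : formCongr ((IsCMField.complexConj L) : L →+* L) gstar (t • Jstar) = Matrix.diagonal dJ)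
    (e : Fin 2 × Fin 1 ≃ Fin 2) (a : (↥(maximalRealSubfield L))ˣ) (χ : Chi ↥(maximalRealSubfield L) L (IsCMField.complexConj L))
    (hJ : (Jstar.map (IsCMField.complexConj L))ᵀ = Jstar) (hJu : IsUnit Jstar) :
    ∃ S₀ : Set (HeightOneSpectrum (𝓞 L)), S₀.Finite ∧
      ∀ w : HeightOneSpectrum (𝓞 L), w ∉ S₀ → ∀ hw : (IsCMField.complexConj L) • w ≠ w,
        (UnitaryGroup.isUnit_placeForm Jstar hJu w).unit ∈ glInt 2 (w.adicCompletion L) →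
          ∀ K : Subgroup ↥(finAdelic ↥(maximalRealSubfield L) L (IsCMField.complexConj L) 2 Jstar),
            UnitaryGroup.IsHyperspecialAt ↥(maximalRealSubfield L) L (IsCMField.complexConj L) 2 Jstar K (w.under (𝓞 ↥(maximalRealSubfield L))) →
            ∀ x ∈ Representation.fixedPoints
                ((rhoVAtLine ↥(maximalRealSubfield L) L (IsCMField.complexConj L) 2
                  e (Matrix.diagonal dJ)
                  (complexConj_imagUnit L) (imagUnit_ne_zero L) (imagUnit_mul_self L) (realDiagonal_isSymm L dJ hdJ)
                  (isUnit_det_realDiagonal L dJ hdJ hdJ0) (realDiagonal_map L dJ hdJ).symm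
                  (fun a => isCompatible_chiSplittingLine L e dJ hdJ hdJ0 θ hθu hθs
                    (TW ↥(maximalRealSubfield L) a) (isSymm_TW ↥(maximalRealSubfield L) a) (isUnit_det_TW ↥(maximalRealSubfield L) a) (JW ↥(maximalRealSubfield L) L a) (JW_eq ↥(maximalRealSubfield L) L a))
                  a χ).comp
                  (finAdelicCongr ↥(maximalRealSubfield L) L (IsCMField.complexConj L) gstar ht hg).symm.toMonoidHom) K,
              UnitaryGroup.heckeTAt ↥(maximalRealSubfield L) L (IsCMField.complexConj L) 2 Jstar
                ((rhoVAtLine ↥(maximalRealSubfield L) L (IsCMField.complexConj L) 2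
                  e (Matrix.diagonal dJ)
                  (complexConj_imagUnit L) (imagUnit_ne_zero L) (imagUnit_mul_self L) (realDiagonal_isSymm L dJ hdJ)
                  (isUnit_det_realDiagonal L dJ hdJ hdJ0) (realDiagonal_map L dJ hdJ).symm
                  (fun a => isCompatible_chiSplittingLine L e dJ hdJ hdJ0 θ hθu hθs
                    (TW ↥(maximalRealSubfield L) a) (isSymm_TW ↥(maximalRealSubfield L) a) (isUnit_det_TW ↥(maximalRealSubfield L) a) (JW ↥(maximalRealSubfield L) L a) (JW_eq ↥(maximalRealSubfield L) L a))
                  a χ).comp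
                  (finAdelicCongr ↥(maximalRealSubfield L) L (IsCMField.complexConj L) gstar ht hg).symm.toMonoidHom)
                K (⟨w, rfl⟩ : UnitaryGroup.PlacesOver L (w.under (𝓞 ↥(maximalRealSubfield L))))
                (IsCMField.complexConj_ne_one L) hJ hw (UnitaryGroup.isUnit_placeForm Jstar hJu w) (HeckeCharacter.uniformizer L w) 1 x =
                (((Real.sqrt (GaloisRepresentations.IsNonarchimedeanLocalField.residueFieldCard (w.adicCompletion L))) : ℂ) *
                  ((((θ.localComponent w) (Units.mk0 ((HeckeCharacter.uniformizer L w : (w.adicCompletion L)ˣ) : w.adicCompletion L)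
                      (Units.ne_zero _)) : ℂˣ) : ℂ) +
                    ((((HeckeCharacter.checkOfChi (complexConj_mul_complexConj' L) χ).localComponent w)
                        (Units.mk0 ((HeckeCharacter.uniformizer L w : (w.adicCompletion L)ˣ) : w.adicCompletion L) (Units.ne_zero _)) : ℂˣ) : ℂ) *
                      ((((θ.localComponent w) (Units.mk0 ((HeckeCharacter.uniformizer L w : (w.adicCompletion L)ˣ) : w.adicCompletion L)
                        (Units.ne_zero _)) : ℂˣ) : ℂ))⁻¹)) • x ∧
              UnitaryGroup.heckeTAt ↥(maximalRealSubfield L) L (IsCMField.complexConj L) 2 Jstar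
                ((rhoVAtLine ↥(maximalRealSubfield L) L (IsCMField.complexConj L) 2
                  e (Matrix.diagonal dJ)
                  (complexConj_imagUnit L) (imagUnit_ne_zero L) (imagUnit_mul_self L) (realDiagonal_isSymm L dJ hdJ)
                  (isUnit_det_realDiagonal L dJ hdJ hdJ0) (realDiagonal_map L dJ hdJ).symm
                  (fun a => isCompatible_chiSplittingLine L e dJ hdJ hdJ0 θ hθu hθs
                    (TW ↥(maximalRealSubfield L) a) (isSymm_TW ↥(maximalRealSubfield L) a) (isUnit_det_TW ↥(maximalRealSubfield L) a) (JW ↥(maximalRealSubfield L) L a) (JW_eq ↥(maximalRealSubfield L) L a))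
                  a χ).comp
                  (finAdelicCongr ↥(maximalRealSubfield L) L (IsCMField.complexConj L) gstar ht hg).symm.toMonoidHom)
                K (⟨w, rfl⟩ : UnitaryGroup.PlacesOver L (w.under (𝓞 ↥(maximalRealSubfield L))))
                (IsCMField.complexConj_ne_one L) hJ hw (UnitaryGroup.isUnit_placeForm Jstar hJu w) (HeckeCharacter.uniformizer L w) 2 x =
                ((((HeckeCharacter.checkOfChi (complexConj_mul_complexConj' L) χ).localComponent w)
                    (Units.mk0 ((HeckeCharacter.uniformizer L w : (w.adicCompletion L)ˣ) : w.adicCompletion L) (Units.ne_zero _)) : ℂˣ) : ℂ) • x := by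
  have hc1 : IsCMField.complexConj L ≠ 1 := IsCMField.complexConj_ne_one L
  have hJd : ((Matrix.diagonal dJ).map (IsCMField.complexConj L))ᵀ = Matrix.diagonal dJ := conjTranspose_realDiagonal L dJ hdJ
  have hJdu : IsUnit (Matrix.diagonal dJ) := isUnit_realDiagonal L dJ hdJ0
  have hJDh := K2LiuSplitPlaceHeckeLocalEnum.conjTranspose_reindex_diagonal_kronecker_JW L e dJ hdJ a
  have hJDu := K2LiuSplitPlaceHeckeLocalEnum.isUnit_reindex_diagonal_kronecker_JW L e dJ hdJ hdJ0 a
  -- S4c-G (A-p05): the survival set `S₁` and the transport of local eigen-equations, at THE CM package of `θ`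
  obtain ⟨S₁, hG⟩ := rhoVAtLine_congr_heckeTAt_apply_eq_smul L e dJ hdJ hdJ0 θ hθu hθs
    a χ (borelPlaceMeasure L)
    (cmFinLocalFamily L e dJ hdJ hdJ0 (lineW L (TW ↥(maximalRealSubfield L) a))
      (complexConj_lineW L (TW ↥(maximalRealSubfield L) a))
      (lineW_ne_zero L (TW ↥(maximalRealSubfield L) a) (isUnit_det_TW ↥(maximalRealSubfield L) a)) θ hθs
      (borelPlaceMeasure L))
    Jstar t ht gstar hg hJ hJd
  -- ONE finite exceptional set of places of `L` (A-p02 (g13) ★ p750778 `exists_finite_splitPlace_conditions'`): `w⁺ ∉ S₁`,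
  -- good reduction of `diag dJ` and of its doubling by the line, integrality of `g⋆⁻¹`, level-matching of the local congruence
  obtain ⟨S₀, hS₀f, hS₀⟩ := exists_finite_splitPlace_conditions' L (IsCMField.complexConj L) hJdu _ hJDu gstar⁻¹ (inv_ne_zero ht)
    (formCongr_inv_smul_of_formCongr gstar ht hg) S₁
  refine ⟨S₀, hS₀f, fun w hwS hw hJwi K hK x hx => ?_⟩
  obtain ⟨hv1, hw4, hw5, hv2, hv3⟩ := hS₀ w hwS
  have hϖ := isUniformizingElement_heckeCharacterUniformizer L w
  -- S4c-G at THIS place (anchor spelt `w.under (𝓞 (Fp L))` = S4c-G's own, so the junction lemmas feed it SYNTACTICALLY), `ϖ := mk0 ↑ϖ_w`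
  have hGw := hG (w.under (𝓞 (Fp L))) hv1 ⟨w, rfl⟩ hw (isUnit_placeForm Jstar hJu w)
    (isUnit_placeForm (Matrix.diagonal dJ) hJdu w) hw4 hv2 hv3 K hK
    (Units.mk0 ((HeckeCharacter.uniformizer L w : (w.adicCompletion L)ˣ) : w.adicCompletion L) hϖ.ne_zero)
  have hϖe : Units.mk0 ((HeckeCharacter.uniformizer L w : (w.adicCompletion L)ˣ) : w.adicCompletion L) hϖ.ne_zero =
      HeckeCharacter.uniformizer L w := Units.mk0_val _ _
  -- the junction (S4c-L at the CM package) at `i = 1, 2`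
  have J1 := K2LiuSplitPlaceHeckeJunctionEnum.cm_hloc_one_enum L θ hθu hθs dJ hdJ hdJ0 e a χ ⟨w, rfl⟩ hw hw5
  have T1a := hGw 1 _ J1
  have T1 := T1a x hx
  have J2 := K2LiuSplitPlaceHeckeJunctionEnum.cm_hloc_two_enum L θ hθu hθs dJ hdJ hdJ0 e a χ ⟨w, rfl⟩ hw hw5
  have T2a := hGw 2 _ J2
  have T2 := T2a x hx
  exact ⟨heckeTAt_apply_eq_of_eq hϖe T1, heckeTAt_apply_eq_of_eq hϖe T2⟩


/-! ## §2 Reading (B) at an arbitrary enumeration -/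

/-- **Reading (B) at an ARBITRARY enumeration `e` and line parameter `a`: the carrier at the `μ`-splitting** (★
`lemD1_splitPlace_heckeEigenvalues_muCarrier` is the case `e = finProdFinEquiv`, `a = r.toFun ε`): for `μ` conjugate-symplectic, off a finite
set, at every split `w` with `J⋆_w ∈ GL₂(𝒪_w)`, every hyperspecial `K`, every fixed `x`:
`T_{w,1} x = (μ^{alg}(ϖ_w) + ((μ^{alg})ᶜ·χ̌)(ϖ_w)) • x` and `N(w) • T_{w,2} x = (μ^{alg}(ϖ_w)·((μ^{alg})ᶜ·χ̌)(ϖ_w)) • x`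
(`lemD1_splitPlace_heckeEigenvalues_chain_enum` + ★ `eigen_eq_labels_of_chain`).
[cite: Liu2021, App. D proof of Lemma D.1, first paragraph (l. 5241, p. 126); Lemma D.1 (2), (3), (4) (l. 5229–5235)] [cite: GelbartRogawski1991, §3.2 p. 457] [cite: CartierCorvallis1979, §IV.2 (4.2)] -/
theorem lemD1_splitPlace_heckeEigenvalues_muCarrier_enum (L : Type) [Field L] [NumberField L] [IsCMField L]
    (μ : Literature.NumberTheory.Automorphic.IdeleClassGroup L →ₜ* Circle)
    (hμ : IdeleClassGroup.IsConjugateSymplectic L μ)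
    (Jstar : Matrix (Fin 2) (Fin 2) L) (t : L) (ht : t ≠ 0) (gstar : GL (Fin 2) L)
    (dJ : Fin 2 → L) (hdJ : ∀ i, IsCMField.complexConj L (dJ i) = dJ i) (hdJ0 : ∀ i, dJ i ≠ 0)
    (hg : formCongr ((IsCMField.complexConj L) : L →+* L) gstar (t • Jstar) = Matrix.diagonal dJ)
    (e : Fin 2 × Fin 1 ≃ Fin 2) (a : (↥(maximalRealSubfield L))ˣ) (χ : Chi ↥(maximalRealSubfield L) L (IsCMField.complexConj L))
    (hJ : (Jstar.map (IsCMField.complexConj L))ᵀ = Jstar) (hJu : IsUnit Jstar) :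
    ∃ S₀ : Set (HeightOneSpectrum (𝓞 L)), S₀.Finite ∧
      ∀ w : HeightOneSpectrum (𝓞 L), w ∉ S₀ → ∀ hw : (IsCMField.complexConj L) • w ≠ w,
        (UnitaryGroup.isUnit_placeForm Jstar hJu w).unit ∈ glInt 2 (w.adicCompletion L) →
          ∀ K : Subgroup ↥(finAdelic ↥(maximalRealSubfield L) L (IsCMField.complexConj L) 2 Jstar),
            UnitaryGroup.IsHyperspecialAt ↥(maximalRealSubfield L) L (IsCMField.complexConj L) 2 Jstar K (w.under (𝓞 ↥(maximalRealSubfield L))) →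
            ∀ x ∈ Representation.fixedPoints
                ((rhoVAtLine ↥(maximalRealSubfield L) L (IsCMField.complexConj L) 2
                  e (Matrix.diagonal dJ)
                  (complexConj_imagUnit L) (imagUnit_ne_zero L) (imagUnit_mul_self L) (realDiagonal_isSymm L dJ hdJ)
                  (isUnit_det_realDiagonal L dJ hdJ hdJ0) (realDiagonal_map L dJ hdJ).symm
                  (fun a => isCompatible_chiSplittingLine L e dJ hdJ hdJ0
                    (toHeckeCharacter L μ)
                    (isUnitary_toHeckeCharacter L μ)
                    ((isOscillatorChar_toHeckeCharacter_iff μ).mpr hμ)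
                    (TW ↥(maximalRealSubfield L) a) (isSymm_TW ↥(maximalRealSubfield L) a) (isUnit_det_TW ↥(maximalRealSubfield L) a) (JW ↥(maximalRealSubfield L) L a) (JW_eq ↥(maximalRealSubfield L) L a))
                  a χ).comp
                  (finAdelicCongr ↥(maximalRealSubfield L) L (IsCMField.complexConj L) gstar ht hg).symm.toMonoidHom) K,
              UnitaryGroup.heckeTAt ↥(maximalRealSubfield L) L (IsCMField.complexConj L) 2 Jstar
                ((rhoVAtLine ↥(maximalRealSubfield L) L (IsCMField.complexConj L) 2
                  e (Matrix.diagonal dJ)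
                  (complexConj_imagUnit L) (imagUnit_ne_zero L) (imagUnit_mul_self L) (realDiagonal_isSymm L dJ hdJ)
                  (isUnit_det_realDiagonal L dJ hdJ hdJ0) (realDiagonal_map L dJ hdJ).symm
                  (fun a => isCompatible_chiSplittingLine L e dJ hdJ hdJ0
                    (toHeckeCharacter L μ)
                    (isUnitary_toHeckeCharacter L μ)
                    ((isOscillatorChar_toHeckeCharacter_iff μ).mpr hμ)
                    (TW ↥(maximalRealSubfield L) a) (isSymm_TW ↥(maximalRealSubfield L) a) (isUnit_det_TW ↥(maximalRealSubfield L) a) (JW ↥(maximalRealSubfield L) L a) (JW_eq ↥(maximalRealSubfield L) L a))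
                  a χ).comp
                  (finAdelicCongr ↥(maximalRealSubfield L) L (IsCMField.complexConj L) gstar ht hg).symm.toMonoidHom)
                K (⟨w, rfl⟩ : UnitaryGroup.PlacesOver L (w.under (𝓞 ↥(maximalRealSubfield L))))
                (IsCMField.complexConj_ne_one L) hJ hw (UnitaryGroup.isUnit_placeForm Jstar hJu w) (HeckeCharacter.uniformizer L w) 1 x =
                ((IdeleClassGroup.muAlg L μ).valueAtUniformizer w +
                  (HeckeCharacter.galConj (IsCMField.complexConj L) (IdeleClassGroup.muAlg L μ) *
                  HeckeCharacter.checkOfChi (complexConj_mul_complexConj' L) χ).valueAtUniformizer w) • x ∧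
              (Ideal.absNorm w.asIdeal : ℂ) •
              UnitaryGroup.heckeTAt ↥(maximalRealSubfield L) L (IsCMField.complexConj L) 2 Jstar
                ((rhoVAtLine ↥(maximalRealSubfield L) L (IsCMField.complexConj L) 2
                  e (Matrix.diagonal dJ)
                  (complexConj_imagUnit L) (imagUnit_ne_zero L) (imagUnit_mul_self L) (realDiagonal_isSymm L dJ hdJ)
                  (isUnit_det_realDiagonal L dJ hdJ hdJ0) (realDiagonal_map L dJ hdJ).symm
                  (fun a => isCompatible_chiSplittingLine L e dJ hdJ hdJ0
                    (toHeckeCharacter L μ)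
                    (isUnitary_toHeckeCharacter L μ)
                    ((isOscillatorChar_toHeckeCharacter_iff μ).mpr hμ)
                    (TW ↥(maximalRealSubfield L) a) (isSymm_TW ↥(maximalRealSubfield L) a) (isUnit_det_TW ↥(maximalRealSubfield L) a) (JW ↥(maximalRealSubfield L) L a) (JW_eq ↥(maximalRealSubfield L) L a))
                  a χ).comp
                  (finAdelicCongr ↥(maximalRealSubfield L) L (IsCMField.complexConj L) gstar ht hg).symm.toMonoidHom)
                K (⟨w, rfl⟩ : UnitaryGroup.PlacesOver L (w.under (𝓞 ↥(maximalRealSubfield L))))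
                (IsCMField.complexConj_ne_one L) hJ hw (UnitaryGroup.isUnit_placeForm Jstar hJu w) (HeckeCharacter.uniformizer L w) 2 x =
                ((IdeleClassGroup.muAlg L μ).valueAtUniformizer w *
                  (HeckeCharacter.galConj (IsCMField.complexConj L) (IdeleClassGroup.muAlg L μ) *
                  HeckeCharacter.checkOfChi (complexConj_mul_complexConj' L) χ).valueAtUniformizer w) • x
 := by
  obtain ⟨S₀, hS₀f, h⟩ := lemD1_splitPlace_heckeEigenvalues_chain_enum L (toHeckeCharacter L μ) (isUnitary_toHeckeCharacter L μ)
    ((isOscillatorChar_toHeckeCharacter_iff μ).mpr hμ) Jstar t ht gstar dJ hdJ hdJ0 hg e a χ hJ hJu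
  refine ⟨S₀, hS₀f, fun w hwS hw hJwi K hK x hx => ?_⟩
  obtain ⟨h₁, h₂⟩ := h w hwS hw hJwi K hK x hx
  exact eigen_eq_labels_of_chain hμ.isConjugateSelfDual _ w (Units.ne_zero _) h₁ h₂

end Summit.HodgeConjecture.HodgeConjecture.Cruxes.HLiu418.K2LiuSplitPlaceHeckeChainEnum

end
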